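import Mathlib
import Literature.Combinatorics.Optimization.DeKlerkPasechnikThetaDual
import Literature.Combinatorics.SimpleGraph.LovaszThetaDual
import Literature.Combinatorics.SimpleGraph.LovaszThetaComplement
import HarnessLib

/-!
# `ϑ^{(0)}(G) ≤ ϑ(G)`: the de Klerk–Pasechnik hierarchy meets the tree's Lovász number; `ϑ(C₅) = √5`

The order-0 de Klerk–Pasechnik bound `ϑ^{(0)}(G) = inf {t : t(I + A_G) - J ∈ K^{(0)}_n}`
(`DeKlerkPasechnikTheta.theta G 0`, `K^{(0)}_n = PSD_n + N_n`) equals Schrijver's `ϑ'(G)`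
[cite: Schrijver1979] and sits below the Lovász number:
`α(G) ≤ ϑ'(G) = ϑ^{(0)}(G) ≤ ϑ(G) ≤ χ(Ḡ)` [cite: LaurentVargas2022, §1 ((1.5) and
"ϑ^{(0)}(G) coincides with ϑ'(G)" [dKP2002])] [cite: DeklerkPasechnik2002, §4]. The tree already has
Lovász's `ϑ` in the trace-one maximisation form (`Literature.Combinatorics.SimpleGraph.lovaszTheta`),
its Knuth dual characterisation `ϑ(H) = min {s : A feasible, sI - A ⪰ 0}` with attainment
(`LovaszThetaDual`) and Lovász's Theorem 8 `ϑ(G)ϑ(Ḡ) = n` for vertex-transitive `G`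
(`LovaszThetaComplement`). This file connects the two developments.

## Main statements

* `entrySum_le_theta_zero`: a theta-feasible `B` of the tree that is entrywise nonnegative
  (`ϑ'`-feasible) has `𝟙ᵀB𝟙 ≤ ϑ^{(0)}(G)`.
* `inParriloCone_zero_dkpMatrix_of_dual`: a Knuth dual solution `A` with `sI - A ⪰ 0` yields the
  order-0 certificate `s(I + A_G) - J = (sI - A) + (A - J + s·A_G) ∈ PSD_n + N_n` (the second summand
  is supported on the edges and nonnegative because `|A_{uv}| ≤ s - 1`); hence
  `theta_zero_le_of_dual`, `inParriloCone_zero_dkpMatrix_lovaszTheta` (the certificate exists at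
  `t = ϑ(G)`, by the attained dual optimum), **`theta_le_lovaszTheta`** (`ϑ^{(r)}(G) ≤ ϑ(G)` for all
  `r`) and the full `sandwich` `α(G) ≤ ϑ^{(r)}(G) ≤ ϑ(G) ≤ k` for any cover by `k` cliques
  [cite: LaurentVargas2022, §1 ((1.5))] [cite: Knuth1994, §6].
* **The pentagon** [cite: Lovasz1979, Theorem 2 (p. 2) and Corollary 5 (p. 5)]: Lovász's umbrella
  as the Gram matrix `B = (1/5)(I + ((√5 - 1)/2) A_{C̄₅})` (rank `3`, certified by an explicit
  sum-of-squares identity over `ℚ(√5)`), which is `ϑ'`-feasible with value `√5`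
  (`sqrt_five_le_theta_zero_cycleGraph_five`, `sqrt_five_le_lovaszTheta_cycleGraph_five`); its
  relabelling by `i ↦ 2i` is feasible for `C̄₅` (`sqrt_five_le_lovaszTheta_cycleGraph_five_compl`);
  `isVertexTransitive_cycleGraph_five` (rotations); and therefore, with the tree's Theorem 8,
  **`lovaszTheta_cycleGraph_five : ϑ(C₅) = √5`**, `lovaszTheta_cycleGraph_five_compl : ϑ(C̄₅) = √5`,
  **`theta_zero_cycleGraph_five : ϑ^{(0)}(C₅) = √5`** and `theta_cycleGraph_five_le_sqrt_five`
  (`ϑ^{(r)}(C₅) ≤ √5`) — sharpening the rational sandwich `38/17 ≤ ϑ^{(0)}(C₅) ≤ 5/2` of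
  `DeKlerkPasechnikThetaDual` [cite: LaurentVargas2022, §1 ("the cycle C_5 has α(C_5) = 2 and
  ϑ-rank 1")].

## Not treated

The reverse inequality `ϑ^{(0)}(G) ≥ ϑ'(G)` as an equality of optimal values (strong duality for the
doubly nonnegative program), `ϑ^{(1)}(C₅) = 2`, and the Shannon capacity `Θ(C₅) = √5` itself.
-/

noncomputable section

namespace Literature.Combinatorics.Optimization.DeKlerkPasechnikLovaszTheta

open Matrix Finset _root_.SimpleGraph
open Literature.Combinatorics.SimpleGraph
open Literature.Algebra.Polynomial.ParriloCopositiveSos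
open Literature.Combinatorics.Optimization.MotzkinStrausCopositive
open Literature.Combinatorics.Optimization.DeKlerkPasechnikTheta
open Literature.Combinatorics.Optimization.DeKlerkPasechnikThetaDual

variable {V : Type*} [Fintype V] [DecidableEq V] (G : SimpleGraph V) [DecidableRel G.Adj]

/-! ## The bridge `ϑ' ≤ ϑ^{(0)} ≤ ϑ` -/

section Bridge

omit [Fintype V] in
/-- Entries of `t(I + A_G) - J`. [folklore] -/
@[folklore] private theorem dkpMatrix_apply' (t : ℝ) (i j : V) :
    dkpMatrix G t i j = t * ((if i = j then 1 else 0) + if G.Adj i j then 1 else 0) - 1 := by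
  simp only [dkpMatrix, msMatrix, onesMatrix, Matrix.sub_apply, Matrix.smul_apply, Matrix.add_apply,
    Matrix.one_apply, SimpleGraph.adjMatrix_apply, Matrix.of_apply, smul_eq_mul]

/-- **`ϑ'(G) ≤ ϑ^{(0)}(G)` over the tree's feasible matrices**: a theta-feasible matrix of the tree
(`IsThetaFeasible`: `B ⪰ 0`, `Tr B = 1`, `B_{uv} = 0` on the edges) which is moreover entrywise
nonnegative — i.e. feasible for Schrijver's `ϑ'(G)` [cite: Schrijver1979] — has
`𝟙ᵀB𝟙 ≤ ϑ^{(0)}(G)` [cite: LaurentVargas2022, §1 ((1.4) and "ϑ^{(0)}(G) coincides with ϑ'(G)"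
[dKP2002])] [cite: DeklerkPasechnik2002, §4]. -/
theorem entrySum_le_theta_zero [Nonempty V] {B : Matrix V V ℝ} (hB : IsThetaFeasible G B)
    (hB' : ∀ u v, 0 ≤ B u v) : entrySum B ≤ theta G 0 :=
  pairing_le_theta_zero G hB.posSemidef hB' (fun _ _ h => hB.apply_eq_zero h)
    (by simpa [Matrix.trace] using hB.trace_eq_one)

/-- **A Knuth dual solution is an order-0 certificate**: if `A` is dual feasible for `ϑ(G)`
(`A_{uv} = 1` for `u = v` or `uv ∉ E`) and `sI - A ⪰ 0`, then
`s(I + A_G) - J = (sI - A) + N` with `N = A - J + s·A_G ≥ 0` (supported on the edges, where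
`|A_{uv}| ≤ s - 1`), so `s(I + A_G) - J ∈ PSD_n + N_n = K^{(0)}_n`
[cite: Knuth1994, §6 ((6.1)–(6.3))] [cite: LaurentVargas2022, §1 ((1.5): ϑ'(G) ≤ ϑ(G), with
ϑ^{(0)} = ϑ')]. -/
theorem inParriloCone_zero_dkpMatrix_of_dual {A : Matrix V V ℝ} {s : ℝ}
    (hA : IsThetaDualFeasible G A) (hs : (s • (1 : Matrix V V ℝ) - A).PosSemidef) :
    InParriloCone 0 (dkpMatrix G s) := by
  have hN : ∀ i j, 0 ≤ (dkpMatrix G s - (s • (1 : Matrix V V ℝ) - A)) i j := by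
    intro i j
    simp only [Matrix.sub_apply, Matrix.smul_apply, Matrix.one_apply, smul_eq_mul, dkpMatrix_apply']
    by_cases hij : i = j
    · subst hij
      rw [hA.apply_eq_one (G.irrefl (v := i))]
      simp
    · by_cases hadj : G.Adj i j
      · have h := (abs_le.1 (abs_apply_le_of_dual hA hs hij)).1
        rw [if_neg hij, if_pos hadj]
        norm_num
        linarith
      · rw [if_neg hij, if_neg hadj, hA.apply_eq_one hadj]
        norm_num
  exact inParriloCone_zero_of_posSemidef_add_nonneg hs hN (by abel)

/-- Hence `ϑ^{(0)}(G) ≤ s` for every Knuth dual solution `A` with `sI - A ⪰ 0`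
[cite: Knuth1994, §6 ((6.3): ϑ = min Λ(A))] [cite: LaurentVargas2022, §1 ((1.5))]. -/
theorem theta_zero_le_of_dual [Nonempty V] {A : Matrix V V ℝ} {s : ℝ}
    (hA : IsThetaDualFeasible G A) (hs : (s • (1 : Matrix V V ℝ) - A).PosSemidef) :
    theta G 0 ≤ s :=
  theta_le_of_inParriloCone G (inParriloCone_zero_dkpMatrix_of_dual G hA hs)

/-- **The order-0 certificate exists at `t = ϑ(G)`**: `ϑ(G)(I + A_G) - J ∈ K^{(0)}_n`, from the
attained dual optimum of the tree (`exists_dual_of_lovaszTheta_eq`, Knuth 1994 §6 / Lovász 1979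
Thm 3) [cite: Knuth1994, §6 ((6.3))] [cite: Lovasz1979, Theorem 3]
[cite: LaurentVargas2022, §1 ((1.5))]. -/
theorem inParriloCone_zero_dkpMatrix_lovaszTheta [Nonempty V] :
    InParriloCone 0 (dkpMatrix G (lovaszTheta G)) := by
  obtain ⟨A, hA, hs⟩ := exists_dual_of_lovaszTheta_eq G
  exact inParriloCone_zero_dkpMatrix_of_dual G hA hs

/-- **`ϑ^{(r)}(G) ≤ ϑ^{(0)}(G) ≤ ϑ(G)`** — the de Klerk–Pasechnik hierarchy starts below the Lovász
number [cite: LaurentVargas2022, §1 ((1.5): `α(G) ≤ ϑ'(G) ≤ ϑ(G) ≤ χ(Ḡ)`, and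
"ϑ^{(0)}(G) coincides with ϑ'(G)" [dKP2002])] [cite: DeklerkPasechnik2002, §4]
[cite: Schrijver1979]. -/
theorem theta_le_lovaszTheta [Nonempty V] (r : ℕ) : theta G r ≤ lovaszTheta G :=
  (theta_anti G (Nat.zero_le r)).trans
    (theta_le_of_inParriloCone G (inParriloCone_zero_dkpMatrix_lovaszTheta G))

/-- **The sandwich `α(G) ≤ ϑ^{(r)}(G) ≤ ϑ(G) ≤ χ(Ḡ)`** [cite: LaurentVargas2022, §1 ((1.5))]
[cite: Lovasz1979]: for a cover of `V` by `k` cliques of `G` (a proper `k`-colouring of `Ḡ`),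
combining `DeKlerkPasechnikTheta.indepNum_le_theta`, `theta_le_lovaszTheta` and the tree's
`lovaszTheta_compl_le_of_coloring`. -/
theorem sandwich [Nonempty V] (r : ℕ) {k : ℕ} (hc : Gᶜ.Colorable k) :
    (G.indepNum : ℝ) ≤ theta G r ∧ theta G r ≤ lovaszTheta G ∧ lovaszTheta G ≤ k := by
  refine ⟨indepNum_le_theta G r, theta_le_lovaszTheta G r, ?_⟩
  obtain ⟨C⟩ := hc
  have h := lovaszTheta_compl_le_of_coloring C
  rwa [compl_compl] at h

end Bridge

/-! ## The pentagon: `ϑ^{(0)}(C₅) = ϑ'(C₅) = ϑ(C₅) = √5` -/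

section Pentagon

/-- The off-diagonal entry `(√5 - 1)/10` of Lovász's umbrella matrix. [folklore] -/
@[folklore] private def gc : ℝ := (Real.sqrt 5 - 1) / 10

/-- `1 ≤ √5`. [folklore] -/
@[folklore] private theorem one_le_sqrt_five : (1 : ℝ) ≤ Real.sqrt 5 := by
  have h := Real.sqrt_le_sqrt (show (1 : ℝ) ≤ 5 by norm_num)
  rwa [Real.sqrt_one] at h

/-- `0 ≤ (√5 - 1)/10`. [folklore] -/
@[folklore] private theorem gc_nonneg : 0 ≤ gc :=
  div_nonneg (by linarith [one_le_sqrt_five]) (by norm_num)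

/-- **Lovász's umbrella as a Gram matrix**: `B = (1/5)(I + ((√5 - 1)/2)·A_{C̄₅})`, the optimal
solution of the `ϑ`-program for `C₅` (`uᵢ = (c + ribs)`, `cᵀuᵢ = 5^{-1/4}`); it is entrywise
nonnegative, so it is also `ϑ'`-feasible. [folklore] -/
@[folklore] private def umbrella : Matrix (Fin 5) (Fin 5) ℝ :=
  !![1/5, 0, gc, gc, 0;
     0, 1/5, 0, gc, gc;
     gc, 0, 1/5, 0, gc;
     gc, gc, 0, 1/5, 0;
     0, gc, gc, 0, 1/5]

/-- `B ⪰ 0`: with `b = (√5 - 1)/2` (so `b² = 1 - b`),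
`5·xᵀBx = (x₀ + b x₂ + b x₃)² + (x₁ + b x₃ + b x₄)² + b (x₂ - b x₃ + x₄)²` — a rank-3 Gram
representation (the umbrella lives in `ℝ³`). [folklore] -/
@[folklore] private theorem umbrella_posSemidef : umbrella.PosSemidef := by
  refine PosSemidef.of_dotProduct_mulVec_nonneg ?_ fun x => ?_
  · unfold Matrix.IsHermitian
    ext i j
    simp only [conjTranspose_apply, star_trivial]
    fin_cases i <;> fin_cases j <;> simp [umbrella]
  · have hs : Real.sqrt 5 ^ 2 = 5 := Real.sq_sqrt (by norm_num)
    have hb : 0 ≤ (Real.sqrt 5 - 1) / 2 := div_nonneg (by linarith [one_le_sqrt_five]) (by norm_num)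
    have hq : star x ⬝ᵥ umbrella *ᵥ x =
        (1 / 5 : ℝ) * ((x 0 + (Real.sqrt 5 - 1) / 2 * x 2 + (Real.sqrt 5 - 1) / 2 * x 3) ^ 2
          + (x 1 + (Real.sqrt 5 - 1) / 2 * x 3 + (Real.sqrt 5 - 1) / 2 * x 4) ^ 2
          + (Real.sqrt 5 - 1) / 2 * (x 2 - (Real.sqrt 5 - 1) / 2 * x 3 + x 4) ^ 2) := by
      simp [dotProduct, Matrix.mulVec, Fin.sum_univ_five, umbrella, gc]
      linear_combination ((1 / 5 : ℝ) * (-(1 / 4) * x 2 ^ 2 - (1 + Real.sqrt 5) / 8 * x 3 ^ 2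
        - 1 / 4 * x 4 ^ 2)) * hs
    rw [hq]
    exact mul_nonneg (by norm_num) (add_nonneg (add_nonneg (sq_nonneg _) (sq_nonneg _))
      (mul_nonneg hb (sq_nonneg _)))

/-- `B ≥ 0` entrywise. [folklore] -/
@[folklore] private theorem umbrella_nonneg (i j : Fin 5) : 0 ≤ umbrella i j := by
  have h := gc_nonneg
  fin_cases i <;> fin_cases j <;> simp [umbrella, h]

/-- `B` vanishes on the edges of `C₅`. [folklore] -/
@[folklore] private theorem umbrella_edges (i j : Fin 5) (h : (cycleGraph 5).Adj i j) :
    umbrella i j = 0 := by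
  revert h
  fin_cases i <;> fin_cases j <;>
    first | (intro h; exact absurd h (by decide)) | (intro; simp [umbrella])

/-- `Tr B = 1`. [folklore] -/
@[folklore] private theorem umbrella_trace : umbrella.trace = 1 := by
  simp [Matrix.trace, Fin.sum_univ_five, umbrella]
  norm_num

/-- `B` is theta-feasible for `C₅`. [folklore] -/
@[folklore] private theorem umbrella_isThetaFeasible : IsThetaFeasible (cycleGraph 5) umbrella :=
  ⟨umbrella_posSemidef, umbrella_trace, fun i j h => umbrella_edges i j h⟩

/-- `𝟙ᵀB𝟙 = 1 + 2·(√5 - 1)/2 = √5`. [folklore] -/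
@[folklore] private theorem entrySum_umbrella : entrySum umbrella = Real.sqrt 5 := by
  simp [entrySum, Fin.sum_univ_five, umbrella, gc]
  ring

/-- **`√5 ≤ ϑ^{(0)}(C₅)`**: the umbrella matrix is `ϑ'`-feasible with value `√5`
[cite: Lovasz1979, Theorem 2 (p. 2, the umbrella) and Corollary 5 (p. 5)]
[cite: LaurentVargas2022, §1 (ϑ^{(0)} = ϑ')]. -/
theorem sqrt_five_le_theta_zero_cycleGraph_five : Real.sqrt 5 ≤ theta (cycleGraph 5) 0 := by
  rw [← entrySum_umbrella]
  exact entrySum_le_theta_zero (cycleGraph 5) umbrella_isThetaFeasible umbrella_nonneg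

/-- **`√5 ≤ ϑ(C₅)`** ("the opposite inequality is known") [cite: Lovasz1979, Theorem 2 (p. 2)]. -/
theorem sqrt_five_le_lovaszTheta_cycleGraph_five : Real.sqrt 5 ≤ lovaszTheta (cycleGraph 5) := by
  rw [← entrySum_umbrella]
  exact le_csSup (bddAbove_thetaValues _) ⟨_, umbrella_isThetaFeasible, rfl⟩

/-- The "doubling" relabelling `i ↦ 2i` of `ℤ/5`, an isomorphism `C₅ ≅ C̄₅`. [folklore] -/
@[folklore] private def doubling : Fin 5 → Fin 5 := ![0, 2, 4, 1, 3]

/-- The relabelled umbrella `B_{2i,2j}` is theta-feasible for the complement `C̄₅` (the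
pentagram). [folklore] -/
@[folklore] private theorem umbrella_submatrix_isThetaFeasible :
    IsThetaFeasible (cycleGraph 5)ᶜ (umbrella.submatrix doubling doubling) := by
  refine ⟨umbrella_posSemidef.submatrix doubling, ?_, ?_⟩
  · simp [Matrix.trace, Fin.sum_univ_five, umbrella, doubling]
    norm_num
  · intro i j h
    revert h
    fin_cases i <;> fin_cases j <;>
      first
        | (intro h; exact absurd h (by decide))
        | (intro; simp [umbrella, doubling, Matrix.submatrix_apply])

/-- `𝟙ᵀ B_{2·,2·} 𝟙 = √5`. [folklore] -/
@[folklore] private theorem entrySum_umbrella_submatrix :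
    entrySum (umbrella.submatrix doubling doubling) = Real.sqrt 5 := by
  simp [entrySum, Fin.sum_univ_five, umbrella, doubling, Matrix.submatrix_apply, gc]
  ring

/-- **`√5 ≤ ϑ(C̄₅)`** (`C̄₅ ≅ C₅`) [cite: Lovasz1979, Theorem 2 (p. 2)]. -/
theorem sqrt_five_le_lovaszTheta_cycleGraph_five_compl :
    Real.sqrt 5 ≤ lovaszTheta (cycleGraph 5)ᶜ := by
  rw [← entrySum_umbrella_submatrix]
  exact le_csSup (bddAbove_thetaValues _) ⟨_, umbrella_submatrix_isThetaFeasible, rfl⟩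

/-- Rotation by `c`, an automorphism of `C₅`. [folklore] -/
@[folklore] private def rotIso (c : Fin 5) : cycleGraph 5 ≃g cycleGraph 5 where
  toEquiv := Equiv.addRight c
  map_rel_iff' := by
    have key : ∀ a b c : Fin 5, (cycleGraph 5).Adj (a + c) (b + c) ↔ (cycleGraph 5).Adj a b := by
      decide
    intro a b
    exact key a b c

/-- **`C₅` is vertex-transitive** (rotations) [cite: Lovasz1979, p. 2 (definition) and
Theorem 8 (p. 5)]. -/
theorem isVertexTransitive_cycleGraph_five : IsVertexTransitive (cycleGraph 5) := fun u v =>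
  ⟨rotIso (v - u), by simp [rotIso, RelIso.coe_fn_mk]⟩

/-- **Lovász 1979, Theorem 2: `ϑ(C₅) = √5`** [cite: Lovasz1979, Theorem 2 (p. 2) and Corollary 5
(p. 5: ϑ(C_n) = n cos(π/n)/(1 + cos(π/n)) for odd n)], over the tree's `lovaszTheta`: `≥` by the
umbrella matrix, `≤` from the tree's Theorem 8 `ϑ(C₅) ϑ(C̄₅) ≤ 5`
(`lovaszTheta_mul_lovaszTheta_compl_le_card`) and `ϑ(C̄₅) ≥ √5`. -/
theorem lovaszTheta_cycleGraph_five : lovaszTheta (cycleGraph 5) = Real.sqrt 5 := by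
  refine le_antisymm ?_ sqrt_five_le_lovaszTheta_cycleGraph_five
  have hprod := lovaszTheta_mul_lovaszTheta_compl_le_card isVertexTransitive_cycleGraph_five
  simp only [Fintype.card_fin, Nat.cast_ofNat] at hprod
  have hθ : 0 ≤ lovaszTheta (cycleGraph 5) := lovaszTheta_nonneg _
  have h5 : Real.sqrt 5 * Real.sqrt 5 = 5 := Real.mul_self_sqrt (by norm_num)
  have hpos : 0 < Real.sqrt 5 := by positivity
  have h1 : lovaszTheta (cycleGraph 5) * Real.sqrt 5 ≤ Real.sqrt 5 * Real.sqrt 5 :=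
    ((mul_le_mul_of_nonneg_left sqrt_five_le_lovaszTheta_cycleGraph_five_compl hθ).trans hprod).trans
      h5.symm.le
  exact le_of_mul_le_mul_right h1 hpos

/-- **`ϑ(C̄₅) = √5`** as well (Theorem 8: `ϑ(C₅) ϑ(C̄₅) = 5`) [cite: Lovasz1979, Theorem 8 (p. 5)
and Theorem 2]. -/
theorem lovaszTheta_cycleGraph_five_compl : lovaszTheta (cycleGraph 5)ᶜ = Real.sqrt 5 := by
  have hprod := lovaszTheta_mul_lovaszTheta_compl_eq_card isVertexTransitive_cycleGraph_five
  simp only [Fintype.card_fin, Nat.cast_ofNat, lovaszTheta_cycleGraph_five] at hprod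
  have h5 : Real.sqrt 5 * Real.sqrt 5 = 5 := Real.mul_self_sqrt (by norm_num)
  have hpos : 0 < Real.sqrt 5 := by positivity
  exact mul_left_cancel₀ hpos.ne' (hprod.trans h5.symm)

/-- **`ϑ^{(0)}(C₅) = ϑ'(C₅) = ϑ(C₅) = √5`**: the order-0 de Klerk–Pasechnik bound of the pentagon
[cite: LaurentVargas2022, §1 (ϑ^{(0)} = ϑ'; "the cycle C_5 has α(C_5) = 2 and ϑ-rank 1")]
[cite: Lovasz1979, Theorem 2] — sharpening the rational sandwich `38/17 ≤ ϑ^{(0)}(C₅) ≤ 5/2` of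
`DeKlerkPasechnikThetaDual`. -/
theorem theta_zero_cycleGraph_five : theta (cycleGraph 5) 0 = Real.sqrt 5 :=
  le_antisymm ((theta_le_lovaszTheta (cycleGraph 5) 0).trans lovaszTheta_cycleGraph_five.le)
    sqrt_five_le_theta_zero_cycleGraph_five

/-- **`ϑ^{(r)}(C₅) ≤ √5` for every order `r`** [cite: LaurentVargas2022, §1]
[cite: Lovasz1979, Theorem 2]. -/
theorem theta_cycleGraph_five_le_sqrt_five (r : ℕ) : theta (cycleGraph 5) r ≤ Real.sqrt 5 :=
  (theta_le_lovaszTheta (cycleGraph 5) r).trans lovaszTheta_cycleGraph_five.le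

end Pentagon

end Literature.Combinatorics.Optimization.DeKlerkPasechnikLovaszTheta
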